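import Mathlib
import HarnessLib
import Summits.ValiantsHypothesis.ValiantsHypothesis.Theorems.DivisionGapZeroOneTransferStubKasteleynDetSqAux1

/-!
# `det K = D²` for Kasteleyn-type matrices (stub `stub_kasteleynDetSq`)

Route `ValiantsHypothesis/DivisionGap`, crux item `stmt-ValiantsHypothesis-5066`
(`Summit.ValiantsHypothesis.ValiantsHypothesis.Theses.DivisionGap.ZeroOneTransfer`), line
`charged-uncharged`, stub **B1 `stub_kasteleynDetSq`** of the registered skeleton
`Cruxes/ZeroOneTransfer/Lines/charged_uncharged.lean` — the pure ALGEBRA of Kasteleyn's method in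
its Pfaffian-free determinant form (Kasteleyn 1961/1967; Lovász–Plummer, *Matching Theory*,
Thm 8.3.3): for a skew sign function `ε` (with zero diagonal) and half-weights `η` on a finite
vertex set with `ε u v = 0 → η u v = 0`, if every fixed-point-free permutation along `ε`-edges all
of whose cycles are even satisfies `sign σ · ∏_v ε v (σ v) = 1` (the combinatorial Kasteleyn
property), then
`det (ε u v · η u v · η v u) = (Σ_{f fixed-point-free involution} ∏_v η v (f v))²`.

Proof: Leibniz expansion; the terms of permutations with a fixed point vanish (`ε v v = 0`);
the terms of fixed-point-free permutations with an odd cycle cancel in pairs under "reverse the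
odd cycle `c = σ.cycleOf v₀` through the chosen odd-cycle vertex `v₀`", `σ ↦ c⁻¹ c⁻¹ σ`
(`kds_sum_odd_eq_zero`; skew-symmetry gives the sign `(-1)^{odd}`); on even cycle covers the
Kasteleyn property turns each term into `∏_v η v (σ v) · ∏_v η v (σ⁻¹ v)`, and the bijection
even cycle covers ≃ (perfect matchings)² of the helper file (injective by `kds_pair_inj` below,
surjective by `kds_exists_preimage`) gives `kds_sum_evenCovers_eq_sq` and finishes.  No
definitions are introduced.
-/

open Finset Equiv Equiv.Perm

set_option linter.dupNamespace false

namespace Summit.ValiantsHypothesis.ValiantsHypothesis.Theorems.DivisionGapZeroOneTransfer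

variable {V : Type*} [Fintype V] [DecidableEq V]

/-! ## Injectivity of the splitting and the sum identity -/

omit [DecidableEq V] in
/-- If every value of `τ` is `σ` or `σ⁻¹` at the same point, `τ`-cycles lie inside `σ`-cycles.
[folklore] -/
theorem kds_sameCycle_of_near {σ τ : Perm V} (h : ∀ v, τ v = σ v ∨ τ v = σ.symm v)
    {v w : V} (hvw : τ.SameCycle v w) : σ.SameCycle v w := by
  obtain ⟨n, rfl⟩ := hvw.exists_nat_pow_eq
  clear hvw
  induction n with
  | zero => rw [pow_zero, Perm.one_apply]
  | succ n ih =>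
    rw [pow_succ', mul_apply]
    rcases h ((τ ^ n) v) with e | e <;> rw [e]
    · exact sameCycle_apply_right.2 ih
    · exact sameCycle_symm_apply_right.2 ih

omit [Fintype V] [DecidableEq V] in
/-- Trichotomies of the splitting: `σ v` is one of the two split values, and each split value is
`σ v` or `σ⁻¹ v`. [folklore] -/
theorem kds_split_near {σ : Perm V} {col : V → Bool} (v : V) :
    (σ v = (if col v then σ v else σ.symm v) ∨ σ v = (if col v then σ.symm v else σ v)) ∧
    ((if col v then σ v else σ.symm v) = σ v ∨ (if col v then σ v else σ.symm v) = σ.symm v) ∧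
    ((if col v then σ.symm v else σ v) = σ v ∨ (if col v then σ.symm v else σ v) = σ.symm v) := by
  cases col v <;> simp

/-- **Injectivity**: an even cycle cover is determined by its pair of perfect matchings (split
along normalised alternating colourings). [folklore] -/
theorem kds_pair_inj {σ τ : Perm V} {col col' : V → Bool} (ha : ∀ v, col (σ v) = !col v)
    (hn : ∀ v, col (kds_orbit_nonempty σ v).choose = true) (ha' : ∀ v, col' (τ v) = !col' v)
    (hn' : ∀ v, col' (kds_orbit_nonempty τ v).choose = true)
    (h1 : (fun v => if col v then σ v else σ.symm v) = fun v => if col' v then τ v else τ.symm v)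
    (h2 : (fun v => if col v then σ.symm v else σ v) = fun v => if col' v then τ.symm v else τ v) :
    σ = τ := by
  have h1v := fun v => congrFun h1 v
  have h2v := fun v => congrFun h2 v
  -- values of `τ` are values of `σ^{±1}` and conversely
  have hnear1 : ∀ v, τ v = σ v ∨ τ v = σ.symm v := by
    intro v
    rcases (kds_split_near (σ := τ) (col := col') v).1 with e | e
    · rw [e, ← h1v]; exact (kds_split_near v).2.1
    · rw [e, ← h2v]; exact (kds_split_near v).2.2
  have hnear2 : ∀ v, σ v = τ v ∨ σ v = τ.symm v := by
    intro v
    rcases (kds_split_near (σ := σ) (col := col) v).1 with e | e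
    · rw [e, h1v]; exact (kds_split_near v).2.1
    · rw [e, h2v]; exact (kds_split_near v).2.2
  have hsame : ∀ v w, σ.SameCycle v w ↔ τ.SameCycle v w := fun v w =>
    ⟨kds_sameCycle_of_near hnear2, kds_sameCycle_of_near hnear1⟩
  -- `col'` is a normalised alternating colouring for `σ` as well
  have ha'' : ∀ v, col' (σ v) = !col' v := by
    intro v
    rcases hnear2 v with e | e
    · rw [e, ha']
    · rw [e, kds_alt_symm_apply ha']
  have hn'' : ∀ v, col' (kds_orbit_nonempty σ v).choose = true := fun v => by
    rw [kds_rep_congr hsame]; exact hn' v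
  have hcol : col = col' := kds_col_unique ha hn ha'' hn''
  subst hcol
  ext v
  have e1 := h1v v
  have e2 := h2v v
  cases hc : col v
  · simp only [hc] at e2; simpa using e2
  · simp only [hc] at e1; simpa using e1

/-- **Even cycle covers ≃ (perfect matchings)²** as a weighted sum identity (Kasteleyn 1961;
Lovász–Plummer Lemma 8.3.1): for arbitrary half-edge weights `η`,
`Σ_{σ fpf, all cycles even} ∏_v η v (σ v) · ∏_v η v (σ⁻¹ v) = (Σ_{f fpf involution} ∏_v η v (f v))²`.
[folklore] -/
theorem kds_sum_evenCovers_eq_sq {R : Type*} [CommRing R] (η : V → V → R) :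
    ∑ σ ∈ univ.filter (fun σ : Perm V =>
        (∀ v, σ v ≠ v) ∧ ∀ c ∈ σ.cycleFactorsFinset, Even c.support.card),
      (∏ v, η v (σ v)) * ∏ v, η v (σ.symm v) =
    (∑ f ∈ (univ : Finset (V → V)).filter (fun f => ∀ v, f (f v) = v ∧ f v ≠ v),
      ∏ v, η v (f v)) ^ 2 := by
  classical
  -- the splitting map, kept opaque: `Φ σ` = the pair split along THE normalised colouring
  obtain ⟨Φ, hΦ⟩ : ∃ Φ : Perm V → (V → V) × (V → V), ∀ (σ : Perm V) (col : V → Bool),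
      (∀ v, col (σ v) = !col v) → (∀ v, col (kds_orbit_nonempty σ v).choose = true) →
      Φ σ = (fun v => if col v then σ v else σ.symm v,
        fun v => if col v then σ.symm v else σ v) := by
    refine ⟨fun σ => if h : ∃ col : V → Bool, (∀ v, col (σ v) = !col v) ∧
        ∀ v, col (kds_orbit_nonempty σ v).choose = true then
      (fun v => if h.choose v then σ v else σ.symm v,
        fun v => if h.choose v then σ.symm v else σ v) else (id, id), fun σ col ha hn => ?_⟩
    have h : ∃ col : V → Bool, (∀ v, col (σ v) = !col v) ∧
        ∀ v, col (kds_orbit_nonempty σ v).choose = true := ⟨col, ha, hn⟩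
    dsimp only
    rw [dif_pos h, kds_col_unique h.choose_spec.1 h.choose_spec.2 ha hn]
  rw [sq, sum_mul_sum, ← sum_product']
  refine sum_nbij Φ (fun σ hσ => ?_) (fun σ hσ τ hτ hst => ?_) (fun p hp => ?_) (fun σ hσ => ?_)
  · obtain ⟨hfp, hev⟩ := (mem_filter.1 hσ).2
    obtain ⟨col, ha, hn⟩ := kds_exists_col σ hfp hev
    rw [hΦ σ col ha hn]
    exact kds_pair_mem hfp ha
  · simp only [coe_filter, Set.mem_setOf_eq, mem_univ, true_and] at hσ hτ
    obtain ⟨col, ha, hn⟩ := kds_exists_col σ hσ.1 hσ.2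
    obtain ⟨col', ha', hn'⟩ := kds_exists_col τ hτ.1 hτ.2
    rw [hΦ σ col ha hn, hΦ τ col' ha' hn', Prod.mk.injEq] at hst
    exact kds_pair_inj ha hn ha' hn' hst.1 hst.2
  · obtain ⟨p1, p2⟩ := p
    rw [mem_coe, mem_product, mem_filter, mem_filter] at hp
    obtain ⟨σ, col, hfp, ha, hn, e1, e2⟩ := kds_exists_preimage hp.1.2 hp.2.2
    refine ⟨σ, ?_, ?_⟩
    · rw [mem_coe, mem_filter]
      exact ⟨mem_univ _, hfp, kds_alt_even_card_support ha⟩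
    · rw [hΦ σ col ha hn]
      exact Prod.ext (funext e1) (funext e2)
  · obtain ⟨hfp, hev⟩ := (mem_filter.1 hσ).2
    obtain ⟨col, ha, hn⟩ := kds_exists_col σ hfp hev
    rw [hΦ σ col ha hn, ← prod_mul_distrib, ← prod_mul_distrib]
    exact prod_congr rfl fun v _ => by cases hc : col v <;> simp [hc, mul_comm]

/-! ## Reversing one cycle of a permutation: `σ ↦ c⁻¹ c⁻¹ σ`, `c = σ.cycleOf v₀` -/

/-- Pointwise: `c⁻¹ c⁻¹ σ` is `σ⁻¹` on the cycle of `v₀` and `σ` elsewhere. [folklore] -/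
theorem kds_rev_apply (σ : Perm V) (v₀ v : V) :
    ((σ.cycleOf v₀)⁻¹ * (σ.cycleOf v₀)⁻¹ * σ) v = if σ.SameCycle v₀ v then σ.symm v else σ v := by
  simp only [Perm.mul_apply, cycleOf_inv, cycleOf_apply, sameCycle_inv, Perm.coe_inv]
  by_cases h : σ.SameCycle v₀ v
  · have h1 : σ.SameCycle v₀ (σ v) := sameCycle_apply_right.2 h
    rw [if_pos h1, symm_apply_apply, if_pos h, if_pos h]
  · have h1 : ¬ σ.SameCycle v₀ (σ v) := fun h' => h (sameCycle_apply_right.1 h')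
    rw [if_neg h1, if_neg h1, if_neg h]

/-- `c⁻¹ c⁻¹ σ` is fixed-point-free if `σ` is. [folklore] -/
theorem kds_rev_ne (σ : Perm V) (v₀ : V) (hfp : ∀ v, σ v ≠ v) (v : V) :
    ((σ.cycleOf v₀)⁻¹ * (σ.cycleOf v₀)⁻¹ * σ) v ≠ v := by
  rw [kds_rev_apply]
  split_ifs
  · exact fun e => hfp v ((Equiv.apply_eq_iff_eq_symm_apply σ).2 e.symm)
  · exact hfp v

/-- The cycle factors of `c⁻¹ c⁻¹ σ`: those of `σ` with `c` replaced by `c⁻¹`. [folklore] -/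
theorem kds_rev_cycleFactorsFinset (σ : Perm V) (v₀ : V) (h : σ v₀ ≠ v₀) :
    ((σ.cycleOf v₀)⁻¹ * (σ.cycleOf v₀)⁻¹ * σ).cycleFactorsFinset =
      insert (σ.cycleOf v₀)⁻¹ (σ.cycleFactorsFinset \ {σ.cycleOf v₀}) := by
  have hmem := cycleOf_mem_cycleFactorsFinset_iff.2 (mem_support.2 h)
  have hcomm : Commute (σ.cycleOf v₀) σ := self_mem_cycle_factors_commute hmem
  have heq : (σ.cycleOf v₀)⁻¹ * (σ.cycleOf v₀)⁻¹ * σ =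
      (σ.cycleOf v₀)⁻¹ * (σ * (σ.cycleOf v₀)⁻¹) := by
    rw [mul_assoc, hcomm.inv_left.eq]
  rw [heq, Disjoint.cycleFactorsFinset_mul_eq_union,
    ((isCycle_cycleOf σ h).inv).cycleFactorsFinset_eq_singleton,
    cycleFactorsFinset_mul_inv_mem_eq_sdiff hmem, insert_eq]
  exact (disjoint_mul_inv_of_mem_cycleFactorsFinset hmem).symm.inv_left

/-- The cycle of `v₀` in `c⁻¹ c⁻¹ σ` is `c⁻¹`. [folklore] -/
theorem kds_rev_cycleOf (σ : Perm V) (v₀ : V) (h : σ v₀ ≠ v₀) :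
    ((σ.cycleOf v₀)⁻¹ * (σ.cycleOf v₀)⁻¹ * σ).cycleOf v₀ = (σ.cycleOf v₀)⁻¹ := by
  refine (cycle_is_cycleOf (f := (σ.cycleOf v₀)⁻¹ * (σ.cycleOf v₀)⁻¹ * σ) ?_ ?_).symm
  · rw [support_inv]; exact mem_support_cycleOf_iff.2 ⟨SameCycle.refl _ _, mem_support.2 h⟩
  · rw [kds_rev_cycleFactorsFinset σ v₀ h]; exact mem_insert_self _ _

/-- Reversing a cycle does not change any cycle length. [folklore] -/
theorem kds_rev_card_support_cycleOf (σ : Perm V) (v₀ : V) (hfp : ∀ v, σ v ≠ v) (v : V) :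
    (((σ.cycleOf v₀)⁻¹ * (σ.cycleOf v₀)⁻¹ * σ).cycleOf v).support.card =
      (σ.cycleOf v).support.card := by
  have h := hfp v₀
  have hτv := kds_rev_ne σ v₀ hfp v
  have hmemτ := cycleOf_mem_cycleFactorsFinset_iff.2 (mem_support.2 hτv)
  have hvτ : v ∈ (((σ.cycleOf v₀)⁻¹ * (σ.cycleOf v₀)⁻¹ * σ).cycleOf v).support :=
    mem_support_cycleOf_iff.2 ⟨SameCycle.refl _ _, mem_support.2 hτv⟩
  rw [kds_rev_cycleFactorsFinset σ v₀ h, mem_insert, mem_sdiff] at hmemτ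
  rcases hmemτ with e | ⟨hm, -⟩
  · rw [e, support_inv] at hvτ ⊢
    rw [← cycle_is_cycleOf hvτ (cycleOf_mem_cycleFactorsFinset_iff.2 (mem_support.2 h))]
  · rw [cycle_is_cycleOf hvτ hm]

/-- For skew-symmetric `K`, reversing the cycle through `v₀` multiplies `∏_v K v (σ v)` by
`(-1) ^ (length of that cycle)`. [folklore] -/
theorem kds_rev_prod {R : Type*} [CommRing R] (K : V → V → R) (hK : ∀ u v, K v u = -K u v)
    (σ : Perm V) (v₀ : V) (h : σ v₀ ≠ v₀) :
    ∏ v, K v (((σ.cycleOf v₀)⁻¹ * (σ.cycleOf v₀)⁻¹ * σ) v) =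
      (-1) ^ (σ.cycleOf v₀).support.card * ∏ v, K v (σ v) := by
  set A := (σ.cycleOf v₀).support with hA
  have hAm : ∀ v, v ∈ A ↔ σ.SameCycle v₀ v := fun v => mem_support_cycleOf_iff' h
  rw [← prod_mul_prod_compl A (fun v => K v (((σ.cycleOf v₀)⁻¹ * (σ.cycleOf v₀)⁻¹ * σ) v)),
    ← prod_mul_prod_compl A (fun v => K v (σ v))]
  have h1 : ∏ v ∈ Aᶜ, K v (((σ.cycleOf v₀)⁻¹ * (σ.cycleOf v₀)⁻¹ * σ) v) =
      ∏ v ∈ Aᶜ, K v (σ v) :=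
    prod_congr rfl fun v hv => by
      rw [kds_rev_apply, if_neg fun h' => (mem_compl.1 hv) ((hAm v).2 h')]
  have h2 : ∏ v ∈ A, K v (((σ.cycleOf v₀)⁻¹ * (σ.cycleOf v₀)⁻¹ * σ) v) =
      (-1) ^ A.card * ∏ v ∈ A, K v (σ v) := by
    calc ∏ v ∈ A, K v (((σ.cycleOf v₀)⁻¹ * (σ.cycleOf v₀)⁻¹ * σ) v)
          = ∏ v ∈ A, K v (σ.symm v) :=
          prod_congr rfl fun v hv => by rw [kds_rev_apply, if_pos ((hAm v).1 hv)]
      _ = ∏ v ∈ A, K (σ v) v := by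
          refine prod_nbij' (fun v => σ.symm v) (fun v => σ v) ?_ ?_ ?_ ?_ ?_
          · intro v hv; exact (hAm _).2 (sameCycle_symm_apply_right.2 ((hAm v).1 hv))
          · intro v hv; exact (hAm _).2 (sameCycle_apply_right.2 ((hAm v).1 hv))
          · intro v _; exact apply_symm_apply _ _
          · intro v _; exact symm_apply_apply _ _
          · intro v _; rw [apply_symm_apply]
      _ = ∏ v ∈ A, (-1) * K v (σ v) := prod_congr rfl fun v _ => by rw [hK v (σ v), neg_one_mul]
      _ = (-1) ^ A.card * ∏ v ∈ A, K v (σ v) := by rw [prod_mul_distrib, prod_const]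
  rw [h1, h2, mul_assoc]

/-! ## Odd cycles cancel -/

/-- A fixed-point-free permutation has a vertex on an odd cycle iff not all its cycles are even.
[folklore] -/
theorem kds_oddVerts_nonempty_iff (σ : Perm V) (hfp : ∀ v, σ v ≠ v) :
    (univ.filter fun v => ¬ Even (σ.cycleOf v).support.card).Nonempty ↔
      ¬ ∀ c ∈ σ.cycleFactorsFinset, Even c.support.card := by
  constructor
  · rintro ⟨v, hv⟩ hall
    exact (mem_filter.1 hv).2
      (hall _ (cycleOf_mem_cycleFactorsFinset_iff.2 (mem_support.2 (hfp v))))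
  · intro hn
    by_contra hne
    refine hn fun c hc => ?_
    by_contra hodd
    obtain ⟨x, hx⟩ : c.support.Nonempty :=
      card_pos.1 (Nat.pos_of_ne_zero fun h0 => hodd (h0 ▸ Even.zero))
    exact hne ⟨x, mem_filter.2 ⟨mem_univ _, by rwa [← cycle_is_cycleOf hx hc]⟩⟩

/-- **Odd cycles cancel**: for skew-symmetric `K` with zero diagonal, the Leibniz terms of the
permutations that are NOT even cycle covers sum to zero (sign-reversing involution: reverse the
odd cycle through the chosen odd-cycle vertex). [folklore] -/
theorem kds_sum_odd_eq_zero {R : Type*} [CommRing R] (K : V → V → R)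
    (hK : ∀ u v, K v u = -K u v) (hK0 : ∀ v, K v v = 0) :
    ∑ σ ∈ univ.filter (fun σ : Perm V =>
        ¬ ((∀ v, σ v ≠ v) ∧ ∀ c ∈ σ.cycleFactorsFinset, Even c.support.card)),
      ((sign σ : ℤ) : R) * ∏ v, K v (σ v) = 0 := by
  -- the term vanishes at permutations with a fixed point
  have hfix : ∀ σ : Perm V, (∃ v, σ v = v) → ((sign σ : ℤ) : R) * ∏ v, K v (σ v) = 0 := by
    rintro σ ⟨v, hv⟩
    rw [prod_eq_zero (mem_univ v) (by rw [hv, hK0]), mul_zero]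
  have hgood : ∀ σ ∈ univ.filter (fun σ : Perm V =>
      ¬ ((∀ v, σ v ≠ v) ∧ ∀ c ∈ σ.cycleFactorsFinset, Even c.support.card)), (∀ v, σ v ≠ v) →
      (univ.filter fun v => ¬ Even (σ.cycleOf v).support.card).Nonempty := fun σ hσ hfp =>
    (kds_oddVerts_nonempty_iff σ hfp).2 fun hall => (mem_filter.1 hσ).2 ⟨hfp, hall⟩
  have hodd : ∀ (σ : Perm V)
      (hne : (univ.filter fun v => ¬ Even (σ.cycleOf v).support.card).Nonempty),
      ¬ Even (σ.cycleOf hne.choose).support.card := fun σ hne => (mem_filter.1 hne.choose_spec).2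
  -- the involution, kept opaque
  obtain ⟨θ, hθ, hθ'⟩ : ∃ θ : Perm V → Perm V,
      (∀ (σ : Perm V) (hfp : ∀ v, σ v ≠ v)
        (hne : (univ.filter fun v => ¬ Even (σ.cycleOf v).support.card).Nonempty),
        θ σ = (σ.cycleOf hne.choose)⁻¹ * (σ.cycleOf hne.choose)⁻¹ * σ) ∧
      ∀ σ : Perm V, (¬ ∀ v, σ v ≠ v) → θ σ = σ := by
    refine ⟨fun σ => if h : (∀ v, σ v ≠ v) ∧
        (univ.filter fun v => ¬ Even (σ.cycleOf v).support.card).Nonempty then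
      (σ.cycleOf h.2.choose)⁻¹ * (σ.cycleOf h.2.choose)⁻¹ * σ else σ,
      fun σ hfp hne => ?_, fun σ hfp => ?_⟩
    · dsimp only; rw [dif_pos ⟨hfp, hne⟩]
    · dsimp only; rw [dif_neg fun h => hfp h.1]
  refine sum_involution (fun σ _ => θ σ) ?_ ?_ ?_ ?_
  · intro σ hσ
    by_cases hfp : ∀ v, σ v ≠ v
    · have hne := hgood σ hσ hfp
      rw [hθ σ hfp hne, Perm.sign_mul, Perm.sign_mul, Int.units_mul_self, one_mul,
        kds_rev_prod K hK σ _ (hfp _), (Nat.not_even_iff_odd.1 (hodd σ hne)).neg_one_pow]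
      ring
    · rw [hθ' σ hfp]
      push Not at hfp
      rw [hfix σ hfp, add_zero]
  · intro σ hσ hne0
    have hfp : ∀ v, σ v ≠ v := by
      by_contra h
      push Not at h
      exact hne0 (hfix σ h)
    have hne := hgood σ hσ hfp
    rw [hθ σ hfp hne]
    intro heq
    set v₀ := hne.choose with hv₀
    have e1 : σ.symm v₀ = σ v₀ := by
      have := congrArg (fun τ : Perm V => τ v₀) heq
      simpa only [kds_rev_apply, if_pos (SameCycle.refl σ v₀)] using this
    have e2 : (σ ^ 2) v₀ = v₀ := by rw [sq, mul_apply, ← e1, apply_symm_apply]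
    have hmm : v₀ ∈ (σ.cycleOf v₀).support :=
      mem_support_cycleOf_iff.2 ⟨SameCycle.refl _ _, mem_support.2 (hfp v₀)⟩
    have hdvd := ((σ.isCycleOn_support_cycleOf v₀).pow_apply_eq hmm).1 e2
    have h2 := (isCycle_cycleOf σ (hfp v₀)).two_le_card_support
    have : (σ.cycleOf v₀).support.card = 2 := le_antisymm (Nat.le_of_dvd two_pos hdvd) h2
    exact hodd σ hne (this ▸ even_two)
  · intro σ hσ
    by_cases hfp : ∀ v, σ v ≠ v
    · have hne := hgood σ hσ hfp
      rw [hθ σ hfp hne, mem_filter]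
      refine ⟨mem_univ _, fun ⟨_, hall⟩ => ?_⟩
      have hc := hall (σ.cycleOf hne.choose)⁻¹
        (by rw [kds_rev_cycleFactorsFinset σ _ (hfp _)]; exact mem_insert_self _ _)
      rw [support_inv] at hc
      exact hodd σ hne hc
    · rw [hθ' σ hfp]; exact hσ
  · intro σ hσ
    by_cases hfp : ∀ v, σ v ≠ v
    · have hne := hgood σ hσ hfp
      rw [hθ σ hfp hne]
      have hfp' := kds_rev_ne σ hne.choose hfp
      have hO : (univ.filter fun v => ¬ Even ((((σ.cycleOf hne.choose)⁻¹ *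
          (σ.cycleOf hne.choose)⁻¹ * σ)).cycleOf v).support.card) =
          univ.filter fun v => ¬ Even (σ.cycleOf v).support.card :=
        filter_congr fun v _ => by rw [kds_rev_card_support_cycleOf σ _ hfp v]
      have hne' : (univ.filter fun v => ¬ Even ((((σ.cycleOf hne.choose)⁻¹ *
          (σ.cycleOf hne.choose)⁻¹ * σ)).cycleOf v).support.card).Nonempty := by
        rw [hO]; exact hne
      rw [hθ _ hfp' hne', kds_choose_congr hne' hne hO, kds_rev_cycleOf σ _ (hfp _), inv_inv]
      group
    · rw [hθ' σ hfp, hθ' σ hfp]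

/-! ## The theorem -/

/-- **Stub B1 `stub_kasteleynDetSq` — Kasteleyn's identity in Pfaffian-free determinant form**
(Kasteleyn 1961/1967; Lovász–Plummer, *Matching Theory*, Thm 8.3.3): for a skew sign function
`ε` with zero diagonal and half-weights `η` on a finite vertex set with `ε u v = 0 → η u v = 0`,
if every fixed-point-free permutation along `ε`-edges all of whose cycles are even has
`sign σ · ∏_v ε v (σ v) = 1`, then
`det (ε u v · η u v · η v u) = (Σ_{f : V → V, f ∘ f = id, f fpf} ∏_v η v (f v))²`. [folklore] -/
theorem stub_kasteleynDetSq :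
    ∀ (V R : Type) [Fintype V] [DecidableEq V] [CommRing R] (ε η : V → V → R),
      (∀ u v, ε u v = -ε v u) → (∀ v, ε v v = 0) → (∀ u v, ε u v = 0 → η u v = 0) →
      (∀ σ : Equiv.Perm V, (∀ v, σ v ≠ v) → (∀ v, ε v (σ v) ≠ 0) →
        (∀ c ∈ σ.cycleFactorsFinset, Even c.support.card) →
        ((Equiv.Perm.sign σ : ℤ) : R) * ∏ v, ε v (σ v) = 1) →
      (Matrix.of fun u v => ε u v * η u v * η v u).det =
        (∑ f ∈ (Finset.univ : Finset (V → V)).filter (fun f => ∀ v, f (f v) = v ∧ f v ≠ v),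
          ∏ v, η v (f v)) ^ 2 := by
  intro V R _ _ _ ε η hskew hdiag hcompat hKP
  obtain ⟨K, hKdef⟩ : ∃ K : V → V → R, ∀ u v, K u v = ε u v * η u v * η v u :=
    ⟨_, fun _ _ => rfl⟩
  have hK : ∀ u v, K v u = -K u v := fun u v => by rw [hKdef, hKdef, hskew v u]; ring
  have hK0 : ∀ v, K v v = 0 := fun v => by rw [hKdef, hdiag]; ring
  have h1 : (Matrix.of fun u v => ε u v * η u v * η v u).det =
      ∑ σ : Perm V, ((sign σ : ℤ) : R) * ∏ v, K v (σ v) := by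
    rw [← Matrix.det_transpose, Matrix.det_apply']
    simp only [Matrix.transpose_apply, Matrix.of_apply, hKdef]
  rw [h1, ← sum_filter_add_sum_filter_not univ
    (fun σ : Perm V => (∀ v, σ v ≠ v) ∧ ∀ c ∈ σ.cycleFactorsFinset, Even c.support.card),
    kds_sum_odd_eq_zero K hK hK0, add_zero, ← kds_sum_evenCovers_eq_sq η]
  refine sum_congr rfl fun σ hσ => ?_
  obtain ⟨hfp, hev⟩ := (mem_filter.1 hσ).2
  by_cases hz : ∀ v, ε v (σ v) ≠ 0
  · have h2 := hKP σ hfp hz hev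
    have h3 : ∏ v, K v (σ v) = (∏ v, ε v (σ v)) * ((∏ v, η v (σ v)) * ∏ v, η (σ v) v) := by
      simp only [hKdef, prod_mul_distrib, mul_assoc]
    rw [h3, ← mul_assoc, h2, one_mul]
    congr 1
    exact Fintype.prod_equiv σ (fun v => η (σ v) v) (fun v => η v (σ.symm v)) fun v => by simp
  · push Not at hz
    obtain ⟨v₀, hv₀⟩ := hz
    rw [prod_eq_zero (mem_univ v₀) (by rw [hKdef, hv₀]; ring),
      prod_eq_zero (f := fun v => η v (σ v)) (mem_univ v₀) (hcompat _ _ hv₀), mul_zero, zero_mul]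

end Summit.ValiantsHypothesis.ValiantsHypothesis.Theorems.DivisionGapZeroOneTransfer
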